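import Literature.AlgebraicGeometry.Resolution.QuadraticTransformsTree
import Literature.AlgebraicGeometry.Resolution.QuadraticTransformWeakTransform
import Literature.AlgebraicGeometry.Resolution.QuadraticTransformsKeyLemma
import Mathlib.RingTheory.RegularLocalRing.Defs
import HarnessLib

/-!
# The marked quadratic tree of an ideal with exponent `b` (the infinitely near points where the
# controlled transform keeps order `≥ b`) and Zariski's count on it

[OURS · L1 W4.6 rung (i-a)′, INVARIANT layer — cell res-hironaka, LADDER-RESOLUTION rung L, D-0089; campaign s46,
seat res-D-pv-044 AS res-L1-s46-pv-8; host route MarkedTransfer, `--supports stmt-ResolutionOfSingularities-16156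
--as helper`.] HONEST FRAMING: nothing here is a statement of H. Hironaka's manuscript (2017-03-23, [Hironaka2017]) and
nothing here asserts that any statement of it holds; this file is PURE COMMUTATIVE ALGEBRA inside a field `K` (no scheme,
no characteristic), the counting machinery behind the germ invariant `ν` of `CampaignW46.PlaneIsolatedFinLocalExitBound`
(res-L1-s46-pv-9's glue `planeIsolatedFinLocalExitBound_of_germLocal`, p498215). AI-written; weaker than expert review.

Classical bookkeeping of embedded order reduction on a regular surface germ (Zariski–Samuel II, App. 5; Hironaka's idealistic exponents `(J, b)` on
surfaces; folklore): let `R` be a two-dimensional regular local ring of the field `K = Frac R`,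
`J ⊆ R` an ideal and `b ≥ 1`. Blow up the closed point; at a two-dimensional first quadratic
transform `R₁ ⊇ R[𝔪_R/x]` (`QuadraticTransforms.lean`) the **controlled transform** of `J` with
exponent `b` is `J₁ = (J R₁ : (𝔪_R R₁)^b)` (`= x^{-b}·J R₁` when `J ⊆ 𝔪_R^b`; the stalk of the
transform of Hironaka's Def. 2.1 at a point over the centre). Iterating through the points where the
transform keeps order `≥ b` AND the previous order was `< 2b` (the exceptional curve is then not
entirely of order `≥ b`: the "isolated singularities" regime) produces the **marked quadratic
tree** `exitTree b ⟨R, J⟩`; its cardinality `exitCount b R J` is the number of point blow-ups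
over the closed point of `Spec R` that the order-`b` reduction of `(J, b)` can perform while the
singular locus stays finite. This file sets up the tree and proves ZARISKI'S COUNT (the analogue of
`sum_baseCount_add_one_le` of `QuadraticTransformsTree.lean`):

* `ctrlTransform b S J S'` — the controlled transform `(J S' : (𝔪_S S')^b)`;
* `MarkedNode K = Σ S, Ideal S`, `IsTameNode b` (two-dimensional regular local ring of `K`,
  `J ⊆ 𝔪^b`, `J ⊄ 𝔪^{2b}`), `IsSingularNode b` (the same without `J ⊄ 𝔪^{2b}`), `MarkedStep b`
  (one quadratic transform out of a tame node, to a two-dimensional member, carrying the controlled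
  transform), `exitTree`, `exitCount`;
* `sum_exitCount_add_one_le` — **if the tree above `(R, J)` is finite then for every finite set
  `F` of distinct two-dimensional first quadratic transforms `R₁` of `R`:
  `∑_{R₁ ∈ F} exitCount b R₁ (ctrlTransform b R J R₁) + 1 ≤ exitCount b R J`** — the subtrees of
  distinct first transforms are disjoint (`IsQuadraticTransform.eq_of_reflTransGen`) and miss the
  root.

Finiteness of the tree (finite branching at tame nodes + no infinite branch, König) is proved in
the sequel files. Everything here is PROVED; pure commutative algebra inside `K`.

## References

* O. Zariski, P. Samuel, *Commutative Algebra* II (1960), Appendix 5. [ZariskiSamuel1960]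
* C. Huneke, I. Swanson, *Integral Closure of Ideals, Rings, and Modules* (2006), §14.2–14.3.
  [HunekeSwanson2006]
* S. D. Cutkosky, Math. Ann. 362 (2015) (arXiv:1404.7459), §2.1. [Cutkosky2014]
-/

noncomputable section

open IsLocalRing

-- single-problem summit: the doubled namespace component `ResolutionOfSingularities` is forced
set_option linter.dupNamespace false

namespace Summit.ResolutionOfSingularities.ResolutionOfSingularities.Theorems.CampaignW46

open Literature.AlgebraicGeometry.Resolution

universe u

variable {K : Type u} [Field K]

/-! ## The controlled transform at a quadratic transform -/

/-- **The controlled transform with exponent `b`** of the ideal `J` of the local ring `S ⊆ K` at an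
over-ring `S' ⊆ K` (meant: a quadratic transform of `S`): `(J S' : (𝔪_S S')^b)`. For `S'` a
first quadratic transform with chart element `x` (`𝔪_S S' = x S'`) and `J ⊆ 𝔪_S^b` this is
`x^{-b} · J S'`, the stalk at a point over the centre of the transform `(J 𝒪' : 𝓘_E^b)` of a point
blow-up (Hironaka's Def. 2.1; the tree's `controlledTransform`). [folklore] -/
def ctrlTransform (b : ℕ) (S : Subring K) [IsLocalRing S] (J : Ideal S) (S' : Subring K) :
    Ideal S' :=
  Submodule.colon (extIdeal J S') (((extIdeal (maximalIdeal S) S') ^ b : Ideal S') : Set S')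

/-! ## Marked nodes and the step relation -/

/-- A **marked node**: a subring `S ⊆ K` together with an ideal of it (the transported marked ideal).
[folklore] -/
abbrev MarkedNode (K : Type u) [Field K] : Type u :=
  (S : Subring K) × Ideal S

/-- A **singular node** for the exponent `b`: `S` is a two-dimensional regular local ring of `K`
(`Frac S = K`) and the marked ideal has order `≥ b` (`J ⊆ 𝔪_S^b`) — the closed point of `Spec S`
lies in `Sing(J, b)`. [folklore] -/
def IsSingularNode (b : ℕ) (n : MarkedNode K) : Prop :=
  ∃ (_ : IsRegularLocalRing n.1), ringKrullDim n.1 = 2 ∧ IsLocalRingOf n.1 ∧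
    n.2 ≤ maximalIdeal n.1 ^ b

/-- A **tame node** for the exponent `b`: a singular node whose marked ideal has order `< 2b`
(`J ⊄ 𝔪_S^{2b}`) — after blowing up the closed point the exceptional curve is NOT contained in the
singular locus of the controlled transform (its multiplicity there is `ord J − b < b`): the only
nodes through which an isolated-singularities reduction may continue. [folklore] -/
def IsTameNode (b : ℕ) (n : MarkedNode K) : Prop :=
  ∃ (_ : IsRegularLocalRing n.1), ringKrullDim n.1 = 2 ∧ IsLocalRingOf n.1 ∧
    n.2 ≤ maximalIdeal n.1 ^ b ∧ ¬ n.2 ≤ maximalIdeal n.1 ^ (2 * b)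

/-- **One step of the marked quadratic tree**: out of a TAME node `⟨S, J⟩`, to a two-dimensional
first quadratic transform `S'` of `S` marked with the controlled transform of `J`. [folklore] -/
def MarkedStep (b : ℕ) (n n' : MarkedNode K) : Prop :=
  IsTameNode b n ∧ ∃ (_ : IsLocalRing n.1), IsQuadraticTransform n.1 n'.1 ∧
    ringKrullDim n'.1 = 2 ∧ n'.2 = ctrlTransform b n.1 n.2 n'.1

/-- **The marked quadratic tree** above the node `n₀`: the nodes reachable from `n₀` by marked steps
(through tame nodes only) which are themselves singular — the infinitely near points over the closed
point of `Spec R` that an isolated-singularities order-`b` reduction of `(J, b)` blows up.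
[cite: ZariskiSamuel1960, Appendix 5] -/
def exitTree (b : ℕ) (n₀ : MarkedNode K) : Set (MarkedNode K) :=
  {n | Relation.ReflTransGen (MarkedStep b) n₀ n ∧ IsSingularNode b n}

/-- **The exit count** `ν(R, J, b)`: the number of nodes of the marked quadratic tree above
`⟨R, J⟩` (`0` if the tree is infinite). [cite: ZariskiSamuel1960, Appendix 5] -/
def exitCount (b : ℕ) (S : Subring K) (J : Ideal S) : ℕ :=
  (exitTree b (⟨S, J⟩ : MarkedNode K)).ncard

/-! ## Elementary properties -/

/-- A tame node is singular. [folklore] -/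
theorem IsTameNode.isSingularNode {b : ℕ} {n : MarkedNode K} (h : IsTameNode b n) :
    IsSingularNode b n := by
  obtain ⟨hreg, hdim, hof, hle, -⟩ := h
  exact ⟨hreg, hdim, hof, hle⟩

/-- The source of a marked step is tame. [folklore] -/
theorem MarkedStep.isTameNode {b : ℕ} {n n' : MarkedNode K} (h : MarkedStep b n n') :
    IsTameNode b n := h.1

/-- A marked step is a quadratic transform of the underlying rings. [folklore] -/
theorem MarkedStep.isQuadraticTransform {b : ℕ} {n n' : MarkedNode K} (h : MarkedStep b n n') :
    IsQuadraticTransform n.1 n'.1 := by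
  obtain ⟨-, _, hq, -, -⟩ := h
  exact hq

/-- The target of a marked step is two-dimensional. [folklore] -/
theorem MarkedStep.ringKrullDim_eq {b : ℕ} {n n' : MarkedNode K} (h : MarkedStep b n n') :
    ringKrullDim n'.1 = 2 := by
  obtain ⟨-, _, -, hd, -⟩ := h
  exact hd

/-- The marked ideal of the target of a marked step is the controlled transform. [folklore] -/
theorem MarkedStep.snd_eq {b : ℕ} {n n' : MarkedNode K} (h : MarkedStep b n n')
    (hS : IsLocalRing n.1) : n'.2 = @ctrlTransform K _ b n.1 hS n.2 n'.1 := by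
  obtain ⟨-, _, -, -, he⟩ := h
  exact he

/-- Reachability in the marked tree projects to the tree of iterated quadratic transforms.
[folklore] -/
theorem reflTransGen_isQuadraticTransform_of_markedStep {b : ℕ} {n n' : MarkedNode K}
    (h : Relation.ReflTransGen (MarkedStep b) n n') :
    Relation.ReflTransGen IsQuadraticTransform n.1 n'.1 := by
  induction h with
  | refl => exact Relation.ReflTransGen.refl
  | tail _ hs ih => exact ih.tail hs.isQuadraticTransform

/-- Membership in the marked tree. [folklore] -/
theorem mem_exitTree_iff {b : ℕ} {n₀ n : MarkedNode K} :
    n ∈ exitTree b n₀ ↔ Relation.ReflTransGen (MarkedStep b) n₀ n ∧ IsSingularNode b n := Iff.rfl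

/-- The root lies in its own tree iff it is singular. [folklore] -/
theorem self_mem_exitTree_iff {b : ℕ} {n₀ : MarkedNode K} :
    n₀ ∈ exitTree b n₀ ↔ IsSingularNode b n₀ :=
  ⟨fun h => h.2, fun h => ⟨Relation.ReflTransGen.refl, h⟩⟩

/-- The tree above the target of a step lies in the tree above its source. [folklore] -/
theorem exitTree_subset_of_markedStep {b : ℕ} {n₀ n₁ : MarkedNode K} (h : MarkedStep b n₀ n₁) :
    exitTree b n₁ ⊆ exitTree b n₀ := fun _ hn =>
  ⟨Relation.ReflTransGen.head h hn.1, hn.2⟩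

/-- **Decomposition through the first steps**: a member of the tree above `n₀` is `n₀` itself or
lies in the tree above the target of a step out of `n₀`. [folklore] -/
theorem mem_exitTree_cases {b : ℕ} {n₀ n : MarkedNode K} (hn : n ∈ exitTree b n₀) :
    n = n₀ ∨ ∃ n₁, MarkedStep b n₀ n₁ ∧ n ∈ exitTree b n₁ := by
  rcases Relation.ReflTransGen.cases_head hn.1 with rfl | ⟨n₁, h₁, h₂⟩
  · exact Or.inl rfl
  · exact Or.inr ⟨n₁, h₁, h₂, hn.2⟩

/-- Out of a node that is not tame there is no step: its tree is `{n₀}` or empty. [folklore] -/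
theorem exitTree_subset_singleton_of_not_isTameNode {b : ℕ} {n₀ : MarkedNode K}
    (h : ¬ IsTameNode b n₀) : exitTree b n₀ ⊆ {n₀} := by
  intro n hn
  rcases mem_exitTree_cases hn with rfl | ⟨n₁, h₁, -⟩
  · rfl
  · exact absurd h₁.isTameNode h

/-- The tree above a node that is not singular is empty. [folklore] -/
theorem exitTree_eq_empty_of_not_isSingularNode {b : ℕ} {n₀ : MarkedNode K}
    (h : ¬ IsSingularNode b n₀) : exitTree b n₀ = ∅ := by
  ext n
  simp only [Set.mem_empty_iff_false, iff_false]
  intro hn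
  have ht : ¬ IsTameNode b n₀ := fun ht => h ht.isSingularNode
  have := exitTree_subset_singleton_of_not_isTameNode ht hn
  rw [Set.mem_singleton_iff] at this
  subst this
  exact h hn.2

/-- A positive exit count at a singular node with finite tree. [folklore] -/
theorem one_le_exitCount {b : ℕ} {S : Subring K} {J : Ideal S}
    (h : IsSingularNode b (⟨S, J⟩ : MarkedNode K))
    (hfin : (exitTree b (⟨S, J⟩ : MarkedNode K)).Finite) : 1 ≤ exitCount b S J := by
  rw [exitCount, Nat.one_le_iff_ne_zero, Ne, Set.ncard_eq_zero hfin]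
  exact fun he => by simpa [he] using self_mem_exitTree_iff.mpr h

/-! ## Zariski's count on the marked tree -/

section Count

variable {b : ℕ} {S : Subring K} [IsRegularLocalRing S] {J : Ideal S}

/-- The marked node of a first quadratic transform. [folklore] -/
def childNode (b : ℕ) (S : Subring K) [IsLocalRing S] (J : Ideal S) (S' : Subring K) :
    MarkedNode K :=
  ⟨S', ctrlTransform b S J S'⟩

omit [IsRegularLocalRing S] in
/-- A tame node steps to each of its two-dimensional first quadratic transforms. [folklore] -/
theorem markedStep_childNode [IsLocalRing S] (hS : IsTameNode b (⟨S, J⟩ : MarkedNode K))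
    {S' : Subring K} (h' : IsQuadraticTransform S S') (hd' : ringKrullDim S' = 2) :
    MarkedStep b (⟨S, J⟩ : MarkedNode K) (childNode b S J S') :=
  ⟨hS, ‹_›, h', hd', rfl⟩

/-- The root is not in the tree above a first quadratic transform. [folklore] -/
theorem root_not_mem_exitTree_childNode (hdim : ringKrullDim S = 2) {S' : Subring K}
    (h' : IsQuadraticTransform S S') {n : MarkedNode K}
    (hn : n ∈ exitTree b (childNode b S J S')) : n ≠ (⟨S, J⟩ : MarkedNode K) := by
  intro he
  have hq := reflTransGen_isQuadraticTransform_of_markedStep hn.1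
  rw [he] at hq
  exact not_reflTransGen_of_isQuadraticTransform h'
    (fun _ z => maximalIdeal_ne_span_singleton hdim z) hq

/-- The trees above distinct first quadratic transforms are disjoint. [folklore] -/
theorem disjoint_exitTree_childNode {S₁ S₂ : Subring K} (h₁ : IsQuadraticTransform S S₁)
    (h₂ : IsQuadraticTransform S S₂) (hne : S₁ ≠ S₂) :
    Disjoint (exitTree b (childNode b S J S₁)) (exitTree b (childNode b S J S₂)) := by
  refine Set.disjoint_left.mpr fun n hn₁ hn₂ => hne ?_
  exact h₁.eq_of_reflTransGen h₂ (IsNoetherian.noetherian _)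
    (reflTransGen_isQuadraticTransform_of_markedStep hn₁.1)
    (reflTransGen_isQuadraticTransform_of_markedStep hn₂.1)

/-- **Zariski's count on the marked tree**: if `⟨S, J⟩` is a tame node with finite marked tree,
then for every finite set `F` of distinct two-dimensional first quadratic transforms `S'` of `S`,
`∑_{S' ∈ F} ν(S', J', b) + 1 ≤ ν(S, J, b)` where `J'` is the controlled transform — the subtrees
of distinct first transforms are disjoint subsets of the tree of `S`, which also contains the root.
(First transforms whose controlled transform has order `< b` contribute `0`.)
[cite: ZariskiSamuel1960, Appendix 5] -/
theorem sum_exitCount_add_one_le (hS : IsTameNode b (⟨S, J⟩ : MarkedNode K))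
    (hfin : (exitTree b (⟨S, J⟩ : MarkedNode K)).Finite) (F : Finset (Subring K))
    (hF : ∀ S' ∈ F, IsQuadraticTransform S S' ∧ ringKrullDim S' = 2) :
    ∑ S' ∈ F, exitCount b S' (ctrlTransform b S J S') + 1 ≤ exitCount b S J := by
  classical
  obtain ⟨_, hdim, -, -, -⟩ := id hS
  -- the subtrees of the members of `F`: subsets of `exitTree ∖ {root}`
  have hsub : ∀ S' ∈ F, exitTree b (childNode b S J S') ⊆
      exitTree b (⟨S, J⟩ : MarkedNode K) \ {(⟨S, J⟩ : MarkedNode K)} := fun S' hS' n hn =>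
    ⟨exitTree_subset_of_markedStep (markedStep_childNode hS (hF S' hS').1 (hF S' hS').2) hn,
      fun he => root_not_mem_exitTree_childNode hdim (hF S' hS').1 hn
        (Set.mem_singleton_iff.mp he)⟩
  have hdisj : ∀ S₁ ∈ F, ∀ S₂ ∈ F, S₁ ≠ S₂ →
      Disjoint (exitTree b (childNode b S J S₁)) (exitTree b (childNode b S J S₂)) :=
    fun S₁ hS₁ S₂ hS₂ hne => disjoint_exitTree_childNode (hF S₁ hS₁).1 (hF S₂ hS₂).1 hne
  -- counting with finsets inside the finite set `T = exitTree b ⟨S, J⟩`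
  set T : Finset (MarkedNode K) := hfin.toFinset with hT
  have hTcard : exitCount b S J = T.card := Set.ncard_eq_toFinset_card _ hfin
  let t : Subring K → Finset (MarkedNode K) := fun S' =>
    T.filter (· ∈ exitTree b (childNode b S J S'))
  have ht : ∀ S' ∈ F, ((t S' : Finset (MarkedNode K)) : Set (MarkedNode K)) =
      exitTree b (childNode b S J S') := by
    intro S' hS'
    ext n
    simp only [t, Finset.coe_filter, Set.Finite.mem_toFinset, Set.mem_setOf_eq, hT]
    exact ⟨fun hn => hn.2, fun hn => ⟨(hsub S' hS' hn).1, hn⟩⟩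
  have htcard : ∀ S' ∈ F, exitCount b S' (ctrlTransform b S J S') = (t S').card :=
    fun S' hS' => by
    rw [exitCount, show (⟨S', ctrlTransform b S J S'⟩ : MarkedNode K) = childNode b S J S' from rfl,
      ← ht S' hS', Set.ncard_coe_finset]
  have hdisj' : (F : Set (Subring K)).PairwiseDisjoint t := by
    intro S₁ hS₁ S₂ hS₂ hne
    rw [Function.onFun, Finset.disjoint_coe.symm, ht S₁ hS₁, ht S₂ hS₂]
    exact hdisj S₁ hS₁ S₂ hS₂ hne
  have hsum : ∑ S' ∈ F, exitCount b S' (ctrlTransform b S J S') = (F.biUnion t).card := by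
    rw [Finset.card_biUnion hdisj']
    exact Finset.sum_congr rfl htcard
  have hRT : (⟨S, J⟩ : MarkedNode K) ∈ T := by
    rw [hT, Set.Finite.mem_toFinset]
    exact self_mem_exitTree_iff.mpr hS.isSingularNode
  have hle : F.biUnion t ⊆ T.erase (⟨S, J⟩ : MarkedNode K) := by
    intro n hn
    obtain ⟨S', hS', hn⟩ := Finset.mem_biUnion.mp hn
    have hn' : n ∈ exitTree b (childNode b S J S') := by rw [← ht S' hS']; exact hn
    obtain ⟨h1, h2⟩ := hsub S' hS' hn'
    exact Finset.mem_erase.mpr ⟨fun e => h2 (Set.mem_singleton_iff.mpr e),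
      by rw [hT, Set.Finite.mem_toFinset]; exact h1⟩
  have hcard := Finset.card_le_card hle
  rw [Finset.card_erase_of_mem hRT] at hcard
  rw [hsum, hTcard]
  have hpos : 0 < T.card := Finset.card_pos.mpr ⟨_, hRT⟩
  omega

/-- The strict form of Zariski's count. [cite: ZariskiSamuel1960, Appendix 5] -/
theorem sum_exitCount_lt (hS : IsTameNode b (⟨S, J⟩ : MarkedNode K))
    (hfin : (exitTree b (⟨S, J⟩ : MarkedNode K)).Finite) (F : Finset (Subring K))
    (hF : ∀ S' ∈ F, IsQuadraticTransform S S' ∧ ringKrullDim S' = 2) :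
    ∑ S' ∈ F, exitCount b S' (ctrlTransform b S J S') < exitCount b S J :=
  sum_exitCount_add_one_le hS hfin F hF

end Count

end Summit.ResolutionOfSingularities.ResolutionOfSingularities.Theorems.CampaignW46

end
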